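import Summits.ResolutionOfSingularities.ResolutionOfSingularities.Theorems.MarkedTransferCampaignW21AlongCentreClass
import Summits.ResolutionOfSingularities.ResolutionOfSingularities.Theorems.MarkedTransferCampaignW21AlongCentreBounds
import Summits.ResolutionOfSingularities.ResolutionOfSingularities.Theorems.MarkedTransferCampaignW21ExactClass
import Summits.ResolutionOfSingularities.ResolutionOfSingularities.Theorems.MarkedTransferCampaignW21LucasBound
import HarnessLib

/-!
# [OURS · L1 W2.1] The D-ADIC Lucas bound along coordinate centres — proofs: `CentreLucasBoundPos p` and
# `CentreWeakBoundCoordPos p` HOLD for every prime `p`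

Rung L (rescue) of cell res-hironaka, RESCUE-SEED row L-G2, slot W2.1 (USE half), seat res-L1-s21-pv-1 (gen 2). Statements:
`MarkedTransferCampaignW21AlongCentreClass.lean` (`degAlong`, `centreIdeal`, `CentreWeakClass`, `CentreLucasBoundPos`,
`CentreWeakBoundCoordPos`). METHOD (the D-adic transcription of res-L1-s21-pv-1's m-adic Lucas bookkeeping, p473059 /
p474444, with «order ≥ N» replaced by «∈ P_w^N» for the prime `P_w = (x_{w j})_j` of a coordinate centre):
(1) a monomial `b·x^m` lies in `P_w^{|m|_D}` (`monomial_mem_centreIdeal_pow`: split off `∏_j x_{w j}^{m_{w j}}`);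
(2) `∂^{(α+pβ)}ε = Σ_j u_j C_j x^{qγ_j} ∈ P_w^{q·μ}` for `μ ≤ min_j |γ_j|_D` (Lucas selection, tree
`le_of_hasseDeriv_monomial_ne_zero`; `hasseDeriv_topFrontier_mem_pow`); (3) `∂^{(qγ₀)}ε ∈ P_w^{s}` when every
digit-dominating shadow `t` has `|t|_D ≥ s + q|γ₀|_D` (`digitLE_of_hasseDeriv_monomial_ne_zero`, p474444;
`hasseDeriv_qgamma_mem_pow`); (4) `H♭(ε) = u₀⁻¹ A B ∈ P_w^{qμ+s}` and `ord_{P_w} ≥ qμ + s` (`le_ordAlong_of_mem_pow`,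
p500718). On `CentreWeakClass w` either `μ ≥ 1` (first factor alone) or `s = q` (class inequality at the minimising
`j`) — `centreWeakBoundCoordPos_holds`. Everything here is OURS / folklore; nothing is a statement of or about the
manuscript under adjudication; AI review is weaker than expert review.
-/

noncomputable section

set_option linter.dupNamespace false -- mandated namespace of this single-conjunct summit

namespace Summit.ResolutionOfSingularities.ResolutionOfSingularities.Theorems

namespace CampaignW21

open Literature.AlgebraicGeometry.Hironaka2017.S08UnitMonomial
open Literature.AlgebraicGeometry.Hironaka2017.S09LLUED
open Literature.AlgebraicGeometry.Hironaka2017.S09LLUED.TopFrontier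
open Literature.AlgebraicGeometry.Resolution
open Literature.RingTheory.MvPowerSeries
open MvPowerSeries Finsupp IsLocalRing

/-! ## 1. D-degrees and monomials in powers of the centre ideal -/

section Monomial

variable (K : Type) [Field K] {n c : ℕ} (w : Fin c → Fin n)

omit K in
/-- `|m + m'|_D = |m|_D + |m'|_D`. [folklore] -/
theorem degAlong_add (m m' : Fin n →₀ ℕ) : degAlong w (m + m') = degAlong w m + degAlong w m' := by
  simp [degAlong, Finset.sum_add_distrib]

omit K in
/-- `|k • m|_D = k |m|_D`. [folklore] -/
theorem degAlong_smul (k : ℕ) (m : Fin n →₀ ℕ) : degAlong w (k • m) = k * degAlong w m := by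
  simp [degAlong, Finset.mul_sum]

/-- The `D`-part `Σ_j m_{w j} e_{w j}` of a multi-index. [folklore] -/
def projAlong (m : Fin n →₀ ℕ) : Fin n →₀ ℕ := ∑ j, Finsupp.single (w j) (m (w j))

variable {w}

omit K in
/-- [folklore] -/
theorem projAlong_apply_w (hw : Function.Injective w) (m : Fin n →₀ ℕ) (j : Fin c) :
    projAlong w m (w j) = m (w j) := by
  rw [projAlong, Finsupp.finsetSum_apply, Finset.sum_eq_single j]
  · rw [Finsupp.single_eq_same]
  · intro j' _ hj'
    rw [Finsupp.single_eq_of_ne (fun h => hj' (hw h).symm)]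
  · intro h; exact absurd (Finset.mem_univ j) h

omit K in
/-- [folklore] -/
theorem projAlong_apply_of_not_mem (m : Fin n →₀ ℕ) {i : Fin n} (hi : i ∉ Set.range w) :
    projAlong w m i = 0 := by
  rw [projAlong, Finsupp.finsetSum_apply]
  refine Finset.sum_eq_zero fun j _ => ?_
  rw [Finsupp.single_eq_of_ne]
  rintro rfl; exact hi ⟨j, rfl⟩

omit K in
/-- `Σ_j m_{w j} e_{w j} ≤ m`. [folklore] -/
theorem projAlong_le (hw : Function.Injective w) (m : Fin n →₀ ℕ) : projAlong w m ≤ m := by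
  intro i
  by_cases hi : i ∈ Set.range w
  · obtain ⟨j, rfl⟩ := hi
    rw [projAlong_apply_w hw]
  · rw [projAlong_apply_of_not_mem m hi]; exact Nat.zero_le _

/-- `∏_j x_{w j}^{m_{w j}} ∈ P_w^{|m|_D}`. [folklore] -/
theorem prod_X_pow_mem_centreIdeal_pow (m : Fin n →₀ ℕ) :
    (∏ j, (X (w j) : MvPowerSeries (Fin n) K) ^ m (w j)) ∈ centreIdeal K w ^ degAlong w m := by
  rw [degAlong, ← Finset.prod_pow_eq_pow_sum]
  refine Ideal.prod_mem_prod fun j _ => Ideal.pow_mem_pow ?_ _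
  exact Ideal.subset_span ⟨j, rfl⟩

/-- `∏_j x_{w j}^{m_{w j}} = x^{Σ_j m_{w j} e_{w j}}`. [folklore] -/
theorem prod_X_pow_eq_monomial_projAlong (m : Fin n →₀ ℕ) :
    (∏ j, (X (w j) : MvPowerSeries (Fin n) K) ^ m (w j)) = monomial (projAlong w m) 1 := by
  rw [projAlong, ← prod_monomial_one]
  exact Finset.prod_congr rfl fun j _ => X_pow_eq (w j) (m (w j))

/-- **`b·x^m ∈ P_w^{|m|_D}`**: a monomial lies in the power of the centre ideal given by its `D`-degree. [folklore] -/
theorem monomial_mem_centreIdeal_pow (hw : Function.Injective w) (m : Fin n →₀ ℕ) (b : K) :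
    (monomial m b : MvPowerSeries (Fin n) K) ∈ centreIdeal K w ^ degAlong w m := by
  have hsplit : (monomial m b : MvPowerSeries (Fin n) K) =
      monomial (m - projAlong w m) b * monomial (projAlong w m) 1 := by
    rw [monomial_mul_monomial, tsub_add_cancel_of_le (projAlong_le hw m), mul_one]
  rw [hsplit, ← prod_X_pow_eq_monomial_projAlong]
  exact Ideal.mul_mem_left _ _ (prod_X_pow_mem_centreIdeal_pow K m)

/-- `f · b·x^m ∈ P_w^N` whenever `N ≤ |m|_D`. [folklore] -/
theorem mul_monomial_mem_centreIdeal_pow (hw : Function.Injective w) (f : MvPowerSeries (Fin n) K)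
    (m : Fin n →₀ ℕ) (b : K) {N : ℕ} (hN : N ≤ degAlong w m) :
    f * monomial m b ∈ centreIdeal K w ^ N :=
  Ideal.pow_le_pow_right hN (Ideal.mul_mem_left _ _ (monomial_mem_centreIdeal_pow K hw m b))

/-- `P_w` is prime (for `w` injective). [folklore] -/
theorem isPrime_centreIdeal (hw : Function.Injective w) : (centreIdeal K w).IsPrime :=
  (MvPowerSeries.isRsopPart_X_of_injective K w hw).isPrime_span_range

/-- `K⟦x⟧/P_w` is a regular local ring: coordinate centres are smooth. [folklore] -/
theorem isRegularLocalRing_quot_centreIdeal (hw : Function.Injective w) :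
    IsRegularLocalRing (MvPowerSeries (Fin n) K ⧸ centreIdeal K w) :=
  (MvPowerSeries.isRsopPart_X_of_injective K w hw).isRegularLocalRing_quotient

end Monomial

/-! ## 2. The two factors of `H♭` along a coordinate centre -/

section Factors

variable (p : ℕ) [hp : Fact p.Prime] {K : Type} [Field K] [CharP K p] {n e ℓ c : ℕ} {w : Fin c → Fin n}

/-- **First factor**: `∂^{(α+pβ)} ε ∈ P_w^{q·μ}` whenever `μ ≤ |γ_j|_D` for every top-block exponent (`0 < e`, coordinates
of `α+pβ` below `p^ℓ`): by Lucas selection only top-block terms survive, and the survivor of `u_j x^{α+pβ+qγ_j}` is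
`u_j · C · x^{qγ_j} ∈ P_w^{q|γ_j|_D}`. [folklore] -/
theorem hasseDeriv_topFrontier_mem_pow (hw : Function.Injective w) (he : 0 < e) {ε : MvPowerSeries (Fin n) K}
    (S : StandardExpression p (xs K n) e ℓ ε) (h0 : 0 < frontierLength S.support S.u)
    (hX : ∀ s, (alpha S.support S.u + p • beta S.support S.u) s < p ^ ℓ) (μ : ℕ)
    (hμ : ∀ j : Fin (frontierLength S.support S.u), μ ≤ degAlong w (gamma S.support S.u j)) :
    hasseDeriv (alpha S.support S.u + p • beta S.support S.u) ε ∈ centreIdeal K w ^ (p ^ e * μ) := by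
  classical
  have key := hasseDeriv_sum_terms p (e := e) S.support S.u S.u_mem hX
  rw [← S.sum_eq] at key
  rw [key]
  refine Ideal.sum_mem _ fun t ht => ?_
  by_cases hu : S.u t = 0
  · rw [hu, zero_mul]; exact Ideal.zero_mem _
  by_cases hD : hasseDeriv (alpha S.support S.u + p • beta S.support S.u)
      (monomial (t.1 + p • t.2.1 + p ^ e • t.2.2) (1 : K)) = 0
  · rw [hD, mul_zero]; exact Ideal.zero_mem _
  have hte : t ∈ effSupport S.support S.u := (mem_effSupport S.support S.u).2 ⟨ht, hu⟩
  have h0T := gamma_mem (T := S.support) (u := S.u) ⟨0, h0⟩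
  obtain ⟨hα, hβ⟩ := le_of_hasseDeriv_monomial_ne_zero he (S.a_lt t ht) (fun i => S.a_lt _ h0T i)
    (S.b_lt t ht) (fun i => S.b_lt _ h0T i) (1 : K) hD
  obtain ⟨h1, h2⟩ := fst_eq_and_snd_eq_of_le hte hα hβ
  obtain ⟨j', hj'⟩ := exists_gamma_eq_of_mem_topBlock ((mem_topBlock S.support S.u).2 ⟨hte, h1, h2⟩)
  rw [h1, h2, hasseDeriv_monomial_add']
  refine mul_monomial_mem_centreIdeal_pow K hw _ _ _ ?_
  rw [degAlong_smul, ← hj']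
  exact Nat.mul_le_mul_left _ (hμ j')

/-- **Second factor**: `∂^{(qγ₀)} ε ∈ P_w^{s}` whenever every effective term `t` with `γ₀ ≼_p c_t` digitwise and
`qγ₀ ≤ a+pb+qc` has `s + q|γ₀|_D ≤ |a+pb+qc|_D` (`0 < e`, coordinates of `qγ₀` below `p^ℓ`). [folklore] -/
theorem hasseDeriv_qgamma_mem_pow (hw : Function.Injective w) (he : 0 < e) {ε : MvPowerSeries (Fin n) K}
    (S : StandardExpression p (xs K n) e ℓ ε) (γ₀ : Fin n →₀ ℕ) (hX : ∀ s, (p ^ e • γ₀) s < p ^ ℓ) (s : ℕ)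
    (hadm : ∀ t ∈ effSupport S.support S.u, (∀ i, DigitLE p (γ₀ i) (t.2.2 i)) →
      p ^ e • γ₀ ≤ t.1 + p • t.2.1 + p ^ e • t.2.2 →
        s + p ^ e * degAlong w γ₀ ≤ degAlong w (t.1 + p • t.2.1 + p ^ e • t.2.2)) :
    hasseDeriv (p ^ e • γ₀) ε ∈ centreIdeal K w ^ s := by
  classical
  have key := hasseDeriv_sum_terms p (e := e) S.support S.u S.u_mem hX
  rw [← S.sum_eq] at key
  rw [key]
  refine Ideal.sum_mem _ fun t ht => ?_
  by_cases hu : S.u t = 0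
  · rw [hu, zero_mul]; exact Ideal.zero_mem _
  by_cases hD : hasseDeriv (p ^ e • γ₀) (monomial (t.1 + p • t.2.1 + p ^ e • t.2.2) (1 : K)) = 0
  · rw [hD, mul_zero]; exact Ideal.zero_mem _
  have hte : t ∈ effSupport S.support S.u := (mem_effSupport S.support S.u).2 ⟨ht, hu⟩
  have hdig := digitLE_of_hasseDeriv_monomial_ne_zero p he (S.a_lt t ht) (S.b_lt t ht) (1 : K) hD
  by_cases hle : p ^ e • γ₀ ≤ t.1 + p • t.2.1 + p ^ e • t.2.2
  · have hN := hadm t hte hdig hle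
    obtain ⟨d, hd⟩ := exists_add_of_le hle
    rw [hd, hasseDeriv_monomial_add']
    rw [hd, degAlong_add, degAlong_smul] at hN
    exact mul_monomial_mem_centreIdeal_pow K hw _ _ _ (by omega)
  · exact absurd (hasseDeriv_monomial_of_not_le' hle (1 : K)) hD

end Factors

/-! ## 3. The D-adic Lucas bound and the consumed inequality on the D-adic class (every prime) -/

/-- **[OURS · L1 W2.1] `H♭(ε) ∈ P_w^{qμ + s}`** under the hypotheses of `CentreLucasBoundPos` (membership form).
[folklore] -/
theorem caseI_mem_centreIdeal_pow (p : ℕ) [Fact p.Prime] (K : Type) [Field K] [CharP K p] (n e ℓ : ℕ)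
    (he : 0 < e) (ε : MvPowerSeries (Fin n) K) (S : StandardExpression p (xs K n) e ℓ ε)
    (h0 : 0 < frontierLength S.support S.u) (hS : Standing p e ℓ ε S h0) (c : ℕ) (w : Fin c → Fin n)
    (hw : Function.Injective w) (μ s : ℕ)
    (hμ : ∀ j : Fin (frontierLength S.support S.u), μ ≤ degAlong w (gamma S.support S.u j))
    (hs : ∀ t ∈ effSupport S.support S.u, (∀ i : Fin n, DigitLE p (gamma S.support S.u ⟨0, h0⟩ i) (t.2.2 i)) →
      p ^ e • gamma S.support S.u ⟨0, h0⟩ ≤ t.1 + p • t.2.1 + p ^ e • t.2.2 →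
        s + p ^ e * degAlong w (gamma S.support S.u ⟨0, h0⟩) ≤ degAlong w (t.1 + p • t.2.1 + p ^ e • t.2.2)) :
    HFlat.caseI (hasseD K n) hS.unit_u0.unit p (p ^ e)
        (alpha S.support S.u) (beta S.support S.u) (gamma S.support S.u ⟨0, h0⟩) ε ∈
      centreIdeal K w ^ (p ^ e * μ + s) := by
  have hXA : ∀ i, (alpha S.support S.u + p • beta S.support S.u) i < p ^ ℓ := fun i =>
    lt_of_le_of_lt ((Finsupp.le_degree i _).trans (Finsupp.degree_mono le_self_add)) hS.depth
  have hXB : ∀ i, (p ^ e • gamma S.support S.u ⟨0, h0⟩) i < p ^ ℓ := fun i =>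
    lt_of_le_of_lt ((Finsupp.le_degree i _).trans (Finsupp.degree_mono le_add_self)) hS.depth
  have hA := hasseDeriv_topFrontier_mem_pow p hw he S h0 hXA μ hμ
  have hB := hasseDeriv_qgamma_mem_pow p hw he S (gamma S.support S.u ⟨0, h0⟩) hXB s hs
  show (↑(hS.unit_u0.unit)⁻¹ : MvPowerSeries (Fin n) K) *
      hasseDeriv (alpha S.support S.u + p • beta S.support S.u) ε *
      hasseDeriv (p ^ e • gamma S.support S.u ⟨0, h0⟩) ε ∈ centreIdeal K w ^ (p ^ e * μ + s)
  rw [mul_assoc, pow_add]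
  exact Ideal.mul_mem_left _ _ (Ideal.mul_mem_mul hA hB)

/-- **[OURS · L1 W2.1] `CentreLucasBoundPos p` HOLDS for every prime `p`.** NOT a statement of the manuscript. [folklore] -/
theorem centreLucasBoundPos_holds (p : ℕ) [Fact p.Prime] : CentreLucasBoundPos p := by
  intro K _ _ n e ℓ he ε S h0 hS c w hw μ s hμ hs _
  exact le_ordAlong_of_mem_pow _ (caseI_mem_centreIdeal_pow p K n e ℓ he ε S h0 hS c w hw μ s hμ hs)

/-- **[OURS · L1 W2.1] `CentreWeakBoundCoordPos p` HOLDS for every prime `p`**: on the D-adic class `CentreWeakClass w`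
the consumed inequality «ord_D H♭(ε) ≥ q» holds along the coordinate centre `w`. With the refutation
(`…AlongCentreRefutation.lean`: the classes mined AT `ξ` do not suffice) this is the slot's USE statement in honest form:
a FOLLOWS-MODULO-⟨every chain head lies in the D-adic class of the chosen centre⟩ shape. NOT a statement of the
manuscript. [folklore] -/
theorem centreWeakBoundCoordPos_holds (p : ℕ) [Fact p.Prime] : CentreWeakBoundCoordPos p := by
  intro K _ _ n e ℓ he ε S h0 hS c w hw hC _
  classical
  -- the minimal D-degree `μ` of the top-block exponents
  obtain ⟨j₀, -, hj₀⟩ := Finset.exists_min_image Finset.univ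
    (fun j : Fin (frontierLength S.support S.u) => degAlong w (gamma S.support S.u j)) ⟨⟨0, h0⟩, Finset.mem_univ _⟩
  set μ := degAlong w (gamma S.support S.u j₀) with hμdef
  by_cases hμ1 : 1 ≤ μ
  · -- `μ ≥ 1`: the first factor alone gives `q ≤ qμ ≤ ord_D H♭`
    have h := le_ordAlong_of_mem_pow (centreIdeal K w)
      (caseI_mem_centreIdeal_pow p K n e ℓ he ε S h0 hS c w hw μ 0 (fun j => hj₀ j (Finset.mem_univ _))
        (fun t _ _ hle => by
          rw [zero_add, degAlong, degAlong]
          exact le_trans (le_of_eq (by simp [Finset.mul_sum])) (Finset.sum_le_sum fun j _ => hle (w j))))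
    refine le_trans ?_ h
    exact_mod_cast (show p ^ e ≤ p ^ e * μ + 0 by rw [add_zero]; exact Nat.le_mul_of_pos_right _ hμ1)
  · -- `μ = 0`: the class hypothesis at `j₀` gives `s = q`
    have hμ0 : μ = 0 := by omega
    have h := le_ordAlong_of_mem_pow (centreIdeal K w)
      (caseI_mem_centreIdeal_pow p K n e ℓ he ε S h0 hS c w hw 0 (p ^ e) (fun j => Nat.zero_le _)
        (fun t ht hdig hle => by
          have := hC h0 j₀ t ht hdig hle
          rw [← hμdef, hμ0, mul_zero, zero_add] at this
          exact this))
    rw [mul_zero, zero_add] at h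
    exact h

end CampaignW21

end Summit.ResolutionOfSingularities.ResolutionOfSingularities.Theorems

end
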